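import Literature.Barriers.CriticalPhenomena.RigorousRGSmallParameterPolymers
import HarnessLib

/-!
# `RigorousRGSmallParameter` (Slade, Theorem 1.4.1): polymer gases — touching, components as a
# hard-core gas, `F^X = ∏_{B ∈ ℬ(X)} F(B)`, and the expansion of a product of sums over sections

Companion ("proof architecture") file of
`Literature/Barriers/CriticalPhenomena/RigorousRGSmallParameter.lean`. The tree reduces that
barrier to the named fact `LongRangePhi4.Slade2017_prop822`, the output of the renormalisation
group, whose single step (Slade's Theorem 6.3.1) is the map `(V, K) ↦ (U₊, K₊)` "defined in
[BS-rg-step]" (Slade §6.3) as a composition of six maps ([BS-rg-step] §3.1); Maps 1 and 4 are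
Brydges' *change of variables* `(I ∘ K_in)(Λ) = (I ∘ K_out)(Λ)` ([BS-rg-step] §4.1, proved in its
appendix "Change of variables"). This file supplies the elementary polymer combinatorics that
proof runs on (everything proved; no named fact is introduced); the change of variables itself
is `RigorousRGSmallParameterKChangeOfVariables.lean`.

Sources: D. Brydges, G. Slade, *A renormalisation group method. V. A single renormalisation group
step*, J. Stat. Phys. 159 (2015) 589–667, arXiv:1403.7256 (read from the TeX source, whose
section numbering is used in the locators below): §1.2 Definition (c) "Connectivity … We say that
two polymers `X, Y` do not touch if `min{|x-y|_∞ : x ∈ X, y ∈ Y} > 1`. A polymer can be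
decomposed into connected components that do not touch; we write `Comp(X)` for the set of
connected components of `X`"; §1.5 "given `F : ℬ_j → 𝒩` and `X ∈ 𝒫_j`, we write
`F^X = F(X) = ∏_{B ∈ ℬ_j(X)} F(B)`"; appendix "Change of variables" (arXiv §11), the step "By
interchanging the sums over blocks `B` … and polymers `U_B`". G. Slade, arXiv:1611.06169, §6.1
(blocks, polymers, `Comp_j`, on the torus; formalised in `…Polymers.lean`).

## What this file provides (all proved)

* `Touch X Y` (`∃ x ∈ X, y ∈ Y` with `x = y` or `|x - y|_∞ = 1`) and its algebra;
  **`not_touch_of_mem_components`** (distinct components do not touch).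
* `IsGas b 𝒢`: a finite family of pairwise non-touching connected `b`-polymers; the bijection
  polymers `↔` gases: **`isGas_components`**, **`IsGas.components_biUnion`**
  (`Comp(⋃𝒢) = 𝒢`), `sum_subpolymers_univ_eq_sum_gasSet` (re-indexing `Σ_{U ∈ 𝒫}` as `Σ_{𝒢}`).
* Sections (graphs of choice functions) `IsSection G D S`, `sectionSet`, and the expansion
  **`prod_sum_eq_sum_sectionSet`**: `∏_{Y ∈ G} Σ_{c ∈ D Y} w(Y,c) = Σ_{S section} ∏_{p ∈ S} w p`
  (this is the "interchange of the sums over blocks and the product over components").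
* `blockProd b F X = ∏_{B ∈ ℬ(X)} F B` (`F^X`): `blockProd_union` (`F^{X∪Y} = F^X F^Y` for disjoint
  polymers), `blockProd_eq_mul_sdiff`, `blockProd_block`, `blockProd_biUnion_of_isGas`.

## References

* [BrydgesSlade2015RGV] D. C. Brydges, G. Slade, *A renormalisation group method. V. A single
  renormalisation group step*, J. Stat. Phys. **159** (2015) 589–667, arXiv:1403.7256 — §1.2,
  §1.5, appendix "Change of variables".
* [Slade2017] G. Slade, *Critical exponents for long-range O(n) models below the upper critical
  dimension*, Commun. Math. Phys. **358** (2018) 343–436, arXiv:1611.06169 — §6.1.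
-/

noncomputable section

open Finset

namespace Literature.Barriers.CriticalPhenomena

namespace LongRangePhi4

namespace Polymer

open Literature.Probability.LatticeModels

variable {d M : ℕ}

/-! ### Touching sets -/

/-- Two sets touch: `min{|x-y|_∞ : x ∈ X, y ∈ Y} ≤ 1`, i.e. they share a point or contain a
pair of `ℓ^∞`-neighbours ("We say that two polymers `X, Y` do not touch if
`min{|x-y|_∞ : x ∈ X, y ∈ Y} > 1`"). [cite: BrydgesSlade2015RGV, Definition 1.1 (c)] -/
def Touch (X Y : Finset (TorusSite d M)) : Prop := ∃ x ∈ X, ∃ y ∈ Y, x = y ∨ AdjInf x y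

/-- Touching is symmetric. [folklore] -/
theorem Touch.symm {X Y : Finset (TorusSite d M)} (h : Touch X Y) : Touch Y X := by
  obtain ⟨x, hx, y, hy, hxy⟩ := h
  refine ⟨y, hy, x, hx, ?_⟩
  rcases hxy with rfl | h
  · exact Or.inl rfl
  · exact Or.inr h.symm

/-- A nonempty set touches itself. [folklore] -/
theorem touch_self {X : Finset (TorusSite d M)} (hX : X.Nonempty) : Touch X X := by
  obtain ⟨x, hx⟩ := hX
  exact ⟨x, hx, x, hx, Or.inl rfl⟩

/-- Touching is monotone in the first set. [folklore] -/
theorem Touch.mono {X X' Y Y' : Finset (TorusSite d M)} (h : Touch X Y) (hX : X ⊆ X') (hY : Y ⊆ Y') :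
    Touch X' Y' := by
  obtain ⟨x, hx, y, hy, hxy⟩ := h
  exact ⟨x, hX hx, y, hY hy, hxy⟩

/-- The empty set touches nothing. [folklore] -/
theorem not_touch_empty_left (Y : Finset (TorusSite d M)) : ¬ Touch ∅ Y := by
  rintro ⟨x, hx, -⟩
  simp at hx

/-- The empty set touches nothing. [folklore] -/
theorem not_touch_empty_right (X : Finset (TorusSite d M)) : ¬ Touch X ∅ := fun h =>
  not_touch_empty_left X h.symm

/-- Sets that intersect touch. [folklore] -/
theorem touch_of_not_disjoint {X Y : Finset (TorusSite d M)} (h : ¬ Disjoint X Y) : Touch X Y := by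
  rw [not_disjoint_iff] at h
  obtain ⟨x, hx, hy⟩ := h
  exact ⟨x, hx, x, hy, Or.inl rfl⟩

/-- Non-touching sets are disjoint. [folklore] -/
theorem disjoint_of_not_touch {X Y : Finset (TorusSite d M)} (h : ¬ Touch X Y) : Disjoint X Y := by
  by_contra h'
  exact h (touch_of_not_disjoint h')

/-- A union touches `Z` iff one of the two pieces does. [folklore] -/
theorem touch_union_left {X Y Z : Finset (TorusSite d M)} : Touch (X ∪ Y) Z ↔ Touch X Z ∨ Touch Y Z := by
  constructor
  · rintro ⟨x, hx, z, hz, hxz⟩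
    rcases mem_union.1 hx with h | h
    · exact Or.inl ⟨x, h, z, hz, hxz⟩
    · exact Or.inr ⟨x, h, z, hz, hxz⟩
  · rintro (h | h)
    · exact h.mono subset_union_left (subset_refl _)
    · exact h.mono subset_union_right (subset_refl _)

/-- A `biUnion` touches `Z` iff one of its pieces does. [folklore] -/
theorem touch_biUnion_left {ι : Type*} {s : Finset ι} {f : ι → Finset (TorusSite d M)}
    {Z : Finset (TorusSite d M)} [DecidableEq (TorusSite d M)] :
    Touch (s.biUnion f) Z ↔ ∃ i ∈ s, Touch (f i) Z := by
  constructor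
  · rintro ⟨x, hx, z, hz, hxz⟩
    obtain ⟨i, hi, hxi⟩ := mem_biUnion.1 hx
    exact ⟨i, hi, x, hxi, z, hz, hxz⟩
  · rintro ⟨i, hi, x, hxi, z, hz, hxz⟩
    exact ⟨x, mem_biUnion.2 ⟨i, hi, hxi⟩, z, hz, hxz⟩

/-! ### Components do not touch each other -/

/-- Two points of `X` at `ℓ^∞`-distance `≤ 1` are joined inside `X`. [folklore] -/
theorem connIn_of_eq_or_adjInf {X : Finset (TorusSite d M)} {x y : TorusSite d M} (hx : x ∈ X) (hy : y ∈ X)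
    (h : x = y ∨ AdjInf x y) : ConnIn X x y := by
  rcases h with rfl | h
  · exact Relation.ReflTransGen.refl
  · exact Relation.ReflTransGen.single ⟨hx, hy, h⟩

/-- **Distinct components of a set do not touch** ("A polymer can be decomposed into connected
components that do not touch"). [cite: BrydgesSlade2015RGV, Definition 1.1 (c)] -/
theorem not_touch_of_mem_components {X Y₁ Y₂ : Finset (TorusSite d M)} (h₁ : Y₁ ∈ components X)
    (h₂ : Y₂ ∈ components X) (hne : Y₁ ≠ Y₂) : ¬ Touch Y₁ Y₂ := by
  rintro ⟨x, hx, y, hy, hxy⟩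
  simp only [components, mem_image] at h₁ h₂
  obtain ⟨x₁, -, rfl⟩ := h₁
  obtain ⟨x₂, -, rfl⟩ := h₂
  have hxX : x ∈ X := comp_subset X x₁ hx
  have hyX : y ∈ X := comp_subset X x₂ hy
  have hc : ConnIn X x y := connIn_of_eq_or_adjInf hxX hyX hxy
  apply hne
  rw [← comp_eq_of_mem hx, ← comp_eq_of_mem hy]
  -- `y ∈ comp X x`
  exact (comp_eq_of_mem (mem_comp.2 ⟨hyX, hc⟩)).symm

/-- Members of `components X` are nonempty. [folklore] -/
theorem nonempty_of_mem_components {X Y : Finset (TorusSite d M)} (h : Y ∈ components X) : Y.Nonempty := by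
  simp only [components, mem_image] at h
  obtain ⟨x, hx, rfl⟩ := h
  exact ⟨x, mem_comp_self hx⟩

/-- Members of `components X` are connected. [folklore] -/
theorem isConn_of_mem_components {X Y : Finset (TorusSite d M)} (h : Y ∈ components X) : IsConn Y := by
  simp only [components, mem_image] at h
  obtain ⟨x, hx, rfl⟩ := h
  exact isConn_comp hx

/-- Members of `components X` are subsets of `X`. [folklore] -/
theorem subset_of_mem_components {X Y : Finset (TorusSite d M)} (h : Y ∈ components X) : Y ⊆ X := by
  simp only [components, mem_image] at h
  obtain ⟨x, -, rfl⟩ := h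
  exact comp_subset X x

/-- `components ∅ = ∅`. [folklore] -/
@[simp] theorem components_empty : components (∅ : Finset (TorusSite d M)) = ∅ := by
  simp [components]

/-- The union of the components is the set. [folklore] -/
theorem biUnion_components_id [DecidableEq (TorusSite d M)] (X : Finset (TorusSite d M)) :
    (components X).biUnion id = X := by
  classical
  have := eq_biUnion_components X
  convert this.symm using 2

/-! ### Gases: finite families of pairwise non-touching connected polymers -/

variable [NeZero M]

/-- A (hard-core) gas of connected `b`-polymers: a finite family of connected polymers, no two of
which touch. The map `X ↦ Comp(X)` is a bijection from polymers onto gases, with inverse the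
union (`isGas_components`, `IsGas.components_biUnion`). [cite: BrydgesSlade2015RGV, Definition 1.1 (c)] -/
def IsGas (b : ℕ) (G : Finset (Finset (TorusSite d M))) : Prop :=
  (∀ Y ∈ G, IsPolymer b Y ∧ IsConn Y) ∧ ∀ Y₁ ∈ G, ∀ Y₂ ∈ G, Y₁ ≠ Y₂ → ¬ Touch Y₁ Y₂

/-- The components of a polymer form a gas. [cite: BrydgesSlade2015RGV, Definition 1.1 (c)] -/
theorem isGas_components {b : ℕ} {X : Finset (TorusSite d M)} (hX : IsPolymer b X) : IsGas b (components X) :=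
  ⟨fun _ hY => hX.of_mem_components hY, fun _ h₁ _ h₂ hne => not_touch_of_mem_components h₁ h₂ hne⟩

/-- In a gas, the component (in the union) of a point of a member is that member. [folklore] -/
theorem IsGas.comp_biUnion_eq {b : ℕ} {G : Finset (Finset (TorusSite d M))} (hG : IsGas b G)
    {Y : Finset (TorusSite d M)} (hY : Y ∈ G) {x : TorusSite d M} (hx : x ∈ Y) :
    comp (G.biUnion id) x = Y := by
  have hYsub : Y ⊆ G.biUnion id := fun y hy => mem_biUnion.2 ⟨Y, hY, hy⟩
  ext z
  rw [mem_comp]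
  constructor
  · rintro ⟨-, hxz⟩
    -- a path in the union starting in `Y` stays in `Y`
    unfold ConnIn at hxz
    induction hxz with
    | refl => exact hx
    | @tail w z' _ hwz ih =>
      obtain ⟨-, hz'U, hadj⟩ := hwz
      obtain ⟨Y', hY', hz'Y'⟩ := mem_biUnion.1 hz'U
      by_cases hYY' : Y = Y'
      · subst hYY'; exact hz'Y'
      · exact absurd ⟨w, ih, z', hz'Y', Or.inr hadj⟩ (hG.2 Y hY Y' hY' hYY')
  · intro hz
    exact ⟨hYsub hz, ((hG.1 Y hY).2.2 x hx z hz).mono hYsub⟩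

/-- **The components of the union of a gas are its members.** [cite: BrydgesSlade2015RGV, Definition 1.1 (c)] -/
theorem IsGas.components_biUnion {b : ℕ} {G : Finset (Finset (TorusSite d M))} (hG : IsGas b G) :
    components (G.biUnion id) = G := by
  ext Y
  simp only [components, mem_image]
  constructor
  · rintro ⟨x, hx, rfl⟩
    obtain ⟨Y', hY', hxY'⟩ := mem_biUnion.1 hx
    rw [hG.comp_biUnion_eq hY' hxY']
    exact hY'
  · intro hY
    obtain ⟨x, hx⟩ := (hG.1 Y hY).2.1
    exact ⟨x, mem_biUnion.2 ⟨Y, hY, hx⟩, hG.comp_biUnion_eq hY hx⟩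

/-- The union of a gas is a polymer. [folklore] -/
theorem IsGas.isPolymer_biUnion {b : ℕ} {G : Finset (Finset (TorusSite d M))} (hG : IsGas b G) :
    IsPolymer b (G.biUnion id) := by
  intro x hx
  obtain ⟨Y, hY, hxY⟩ := mem_biUnion.1 hx
  exact ((hG.1 Y hY).1 hxY).trans fun y hy => mem_biUnion.2 ⟨Y, hY, hy⟩

/-- A sub-family of a gas is a gas. [folklore] -/
theorem IsGas.subset {b : ℕ} {G G' : Finset (Finset (TorusSite d M))} (hG : IsGas b G) (h : G' ⊆ G) : IsGas b G' :=
  ⟨fun Y hY => hG.1 Y (h hY), fun Y₁ h₁ Y₂ h₂ hne => hG.2 Y₁ (h h₁) Y₂ (h h₂) hne⟩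

open Classical in
/-- The finite set of all gases of connected `b`-polymers. [folklore] -/
def gasSet (b : ℕ) : Finset (Finset (Finset (TorusSite d M))) := univ.filter fun G => IsGas b G

/-- Membership in `gasSet`. [folklore] -/
@[simp] theorem mem_gasSet {b : ℕ} {G : Finset (Finset (TorusSite d M))} : G ∈ gasSet b ↔ IsGas b G := by
  classical
  simp [gasSet]

/-- **Polymers ↔ gases**: re-indexing a sum over polymers `U` (with access to `Comp(U)`) as a sum
over gases `𝒢` (with `U = ⋃𝒢`). [cite: BrydgesSlade2015RGV, Definition 1.1 (c)] -/
theorem sum_subpolymers_univ_eq_sum_gasSet {β : Type*} [AddCommMonoid β] (b : ℕ)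
    (f : Finset (TorusSite d M) → Finset (Finset (TorusSite d M)) → β) :
    ∑ U ∈ subpolymers b univ, f U (components U) = ∑ G ∈ gasSet b, f (G.biUnion id) G := by
  classical
  refine Finset.sum_nbij' (fun U => components U) (fun G => G.biUnion id) ?_ ?_ ?_ ?_ ?_
  · intro U hU
    rw [mem_subpolymers] at hU
    exact mem_gasSet.2 (isGas_components hU.2)
  · intro G hG
    rw [mem_gasSet] at hG
    exact mem_subpolymers.2 ⟨subset_univ _, hG.isPolymer_biUnion⟩
  · intro U _
    exact biUnion_components_id U
  · intro G hG
    exact (mem_gasSet.1 hG).components_biUnion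
  · intro U _
    simp only [biUnion_components_id]


/-! ### Sections: expanding a product of sums into a sum over graphs of choice functions -/

section Sections

variable {α κ : Type*} [DecidableEq α] [DecidableEq κ]

/-- The pairs `(Y, c)` with `Y ∈ G`, `c ∈ D Y`. [folklore] -/
def pairsOf (G : Finset α) (D : α → Finset κ) : Finset (α × κ) := G.biUnion fun Y => (D Y).image (Prod.mk Y)

/-- Membership in `pairsOf`. [folklore] -/
@[simp] theorem mem_pairsOf {G : Finset α} {D : α → Finset κ} {p : α × κ} :
    p ∈ pairsOf G D ↔ p.1 ∈ G ∧ p.2 ∈ D p.1 := by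
  constructor
  · intro h
    simp only [pairsOf, mem_biUnion, mem_image] at h
    obtain ⟨Y, hY, c, hc, rfl⟩ := h
    exact ⟨hY, hc⟩
  · rintro ⟨h1, h2⟩
    simp only [pairsOf, mem_biUnion, mem_image]
    exact ⟨p.1, h1, p.2, h2, rfl⟩

/-- A section of `D` over `G`: a set of pairs `(Y, c)`, `c ∈ D Y`, containing exactly one pair
above each `Y ∈ G` and nothing else (the graph of a choice function). [folklore] -/
def IsSection (G : Finset α) (D : α → Finset κ) (S : Finset (α × κ)) : Prop :=
  S ⊆ pairsOf G D ∧ ∀ Y ∈ G, ∃! c, (Y, c) ∈ S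

open Classical in
/-- The finite set of sections of `D` over `G`. [folklore] -/
def sectionSet (G : Finset α) (D : α → Finset κ) : Finset (Finset (α × κ)) :=
  (pairsOf G D).powerset.filter fun S => IsSection G D S

/-- Membership in `sectionSet`. [folklore] -/
@[simp] theorem mem_sectionSet {G : Finset α} {D : α → Finset κ} {S : Finset (α × κ)} :
    S ∈ sectionSet G D ↔ IsSection G D S := by
  classical
  simp only [sectionSet, mem_filter, mem_powerset, and_iff_right_iff_imp]
  exact fun h => h.1

/-- The only section over `∅` is `∅`. [folklore] -/
theorem sectionSet_empty (D : α → Finset κ) : sectionSet (∅ : Finset α) D = {∅} := by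
  ext S
  simp only [mem_sectionSet, IsSection, mem_singleton, Finset.notMem_empty, IsEmpty.forall_iff,
    implies_true, and_true]
  constructor
  · intro h
    exact Finset.subset_empty.1 (fun p hp => by simpa [pairsOf] using h hp)
  · rintro rfl
    exact Finset.empty_subset _

/-- In a section over `G`, first coordinates lie in `G`. [folklore] -/
theorem IsSection.fst_mem {G : Finset α} {D : α → Finset κ} {S : Finset (α × κ)} (hS : IsSection G D S)
    {p : α × κ} (hp : p ∈ S) : p.1 ∈ G :=
  (mem_pairsOf.1 (hS.1 hp)).1

/-- Inserting a new pair above a new point gives a section over the enlarged base. [folklore] -/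
theorem IsSection.insertPair {G : Finset α} {D : α → Finset κ} {S : Finset (α × κ)} (hS : IsSection G D S)
    {Y : α} (hY : Y ∉ G) {c : κ} (hc : c ∈ D Y) : IsSection (insert Y G) D (insert (Y, c) S) := by
  refine ⟨?_, ?_⟩
  · intro p hp
    rcases mem_insert.1 hp with rfl | hp
    · exact mem_pairsOf.2 ⟨mem_insert_self _ _, hc⟩
    · have := mem_pairsOf.1 (hS.1 hp)
      exact mem_pairsOf.2 ⟨mem_insert_of_mem this.1, this.2⟩
  · intro Y' hY'
    rcases mem_insert.1 hY' with rfl | hY'G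
    · refine ⟨c, mem_insert_self _ _, fun c' hc' => ?_⟩
      rcases mem_insert.1 hc' with h | h
      · exact (Prod.mk.injEq _ _ _ _ ▸ h).2
      · exact absurd (hS.fst_mem h) hY
    · obtain ⟨c', hc', huniq⟩ := hS.2 Y' hY'G
      refine ⟨c', mem_insert_of_mem hc', fun c'' hc'' => ?_⟩
      rcases mem_insert.1 hc'' with h | h
      · rw [Prod.mk.injEq] at h
        exact absurd (h.1 ▸ hY'G) hY
      · exact huniq c'' h

/-- Removing the pair above `Y` from a section over `insert Y G` gives a section over `G`. [folklore] -/
theorem IsSection.erasePair {G : Finset α} {D : α → Finset κ} {S : Finset (α × κ)} {Y : α} (hY : Y ∉ G)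
    (hS : IsSection (insert Y G) D S) {c : κ} (hc : (Y, c) ∈ S) : IsSection G D (S.erase (Y, c)) := by
  refine ⟨?_, ?_⟩
  · intro p hp
    rw [mem_erase] at hp
    have h := mem_pairsOf.1 (hS.1 hp.2)
    refine mem_pairsOf.2 ⟨?_, h.2⟩
    rcases mem_insert.1 h.1 with h1 | h1
    · -- `p = (Y, p.2)` with `p.2 ≠ c` would contradict uniqueness above `Y`
      exfalso
      obtain ⟨c₀, -, huniq⟩ := hS.2 Y (mem_insert_self _ _)
      have e1 : p.2 = c₀ := huniq p.2 (by rw [← h1]; exact hp.2)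
      have e2 : c = c₀ := huniq c hc
      exact hp.1 (Prod.ext h1 (e1.trans e2.symm))
    · exact h1
  · intro Y' hY'
    obtain ⟨c', hc', huniq⟩ := hS.2 Y' (mem_insert_of_mem hY')
    refine ⟨c', mem_erase.2 ⟨?_, hc'⟩, fun c'' hc'' => huniq c'' (mem_erase.1 hc'').2⟩
    intro h
    rw [Prod.mk.injEq] at h
    exact hY (h.1 ▸ hY')

/-- **Product of sums = sum over sections** (graphs of choice functions):
`∏_{Y ∈ G} Σ_{c ∈ D Y} w (Y,c) = Σ_{S section} ∏_{p ∈ S} w p`. [folklore] -/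
theorem prod_sum_eq_sum_sectionSet {R : Type*} [CommSemiring R] (G : Finset α) (D : α → Finset κ)
    (w : α × κ → R) :
    ∏ Y ∈ G, ∑ c ∈ D Y, w (Y, c) = ∑ S ∈ sectionSet G D, ∏ p ∈ S, w p := by
  classical
  induction G using Finset.induction_on with
  | empty => simp [sectionSet_empty]
  | @insert Y G hY ih =>
    rw [Finset.prod_insert hY, ih, Finset.sum_mul_sum, ← Finset.sum_product']
    -- reindex `(c, S) ↦ insert (Y, c) S`
    refine Finset.sum_bij (fun q _ => insert (Y, q.1) q.2) ?_ ?_ ?_ ?_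
    · rintro ⟨c, S⟩ hq
      simp only [mem_product, mem_sectionSet] at hq
      exact mem_sectionSet.2 (hq.2.insertPair hY hq.1)
    · rintro ⟨c, S⟩ hq ⟨c', S'⟩ hq' h
      simp only [mem_product, mem_sectionSet] at hq hq'
      have hYS : (Y, c) ∉ S := fun h' => hY (hq.2.fst_mem h')
      have hYS' : (Y, c') ∉ S' := fun h' => hY (hq'.2.fst_mem h')
      have hcc : c = c' := by
        have : (Y, c) ∈ insert (Y, c') S' := h ▸ mem_insert_self _ _
        rcases mem_insert.1 this with e | e
        · exact (Prod.mk.injEq _ _ _ _ ▸ e).2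
        · exact absurd (hq'.2.fst_mem e) hY
      subst hcc
      simp only [Prod.mk.injEq, true_and]
      rw [← erase_insert hYS, h, erase_insert hYS']
    · intro S' hS'
      rw [mem_sectionSet] at hS'
      obtain ⟨c, hc, -⟩ := hS'.2 Y (mem_insert_self _ _)
      refine ⟨(c, S'.erase (Y, c)), ?_, insert_erase hc⟩
      simp only [mem_product, mem_sectionSet]
      exact ⟨(mem_pairsOf.1 (hS'.1 hc)).2, hS'.erasePair hY hc⟩
    · rintro ⟨c, S⟩ hq
      simp only [mem_product, mem_sectionSet] at hq
      have hYS : (Y, c) ∉ S := fun h' => hY (hq.2.fst_mem h')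
      rw [Finset.prod_insert hYS]

/-- In a section, the first projection is injective. [folklore] -/
theorem IsSection.eq_of_fst_eq {G : Finset α} {D : α → Finset κ} {S : Finset (α × κ)} (hS : IsSection G D S)
    {p q : α × κ} (hp : p ∈ S) (hq : q ∈ S) (h : p.1 = q.1) : p = q := by
  obtain ⟨c, -, huniq⟩ := hS.2 p.1 (hS.fst_mem hp)
  have e1 : p.2 = c := huniq p.2 (by simpa using hp)
  have e2 : q.2 = c := huniq q.2 (by rw [h]; simpa using hq)
  exact Prod.ext h (e1.trans e2.symm)

/-- The first projection of a section over `G` is `G`. [folklore] -/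
theorem IsSection.image_fst {G : Finset α} {D : α → Finset κ} {S : Finset (α × κ)} (hS : IsSection G D S) :
    S.image Prod.fst = G := by
  ext Y
  simp only [mem_image]
  constructor
  · rintro ⟨p, hp, rfl⟩
    exact hS.fst_mem hp
  · intro hY
    obtain ⟨c, hc, -⟩ := hS.2 Y hY
    exact ⟨(Y, c), hc, rfl⟩

/-- A set of pairs with injective first projection and admissible second coordinates is a
section over its first projection. [folklore] -/
theorem isSection_image_fst {D : α → Finset κ} {S : Finset (α × κ)} (h2 : ∀ p ∈ S, p.2 ∈ D p.1)
    (hinj : ∀ p ∈ S, ∀ q ∈ S, p.1 = q.1 → p = q) : IsSection (S.image Prod.fst) D S := by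
  refine ⟨fun p hp => mem_pairsOf.2 ⟨mem_image_of_mem _ hp, h2 p hp⟩, ?_⟩
  intro Y hY
  obtain ⟨p, hp, rfl⟩ := mem_image.1 hY
  refine ⟨p.2, by simpa using hp, fun c hc => ?_⟩
  have := hinj _ hc p hp rfl
  rw [← this]

end Sections

/-! ### `I^X = ∏_{B ∈ ℬ(X)} I(B)` -/

/-- `F^X = ∏_{B ∈ ℬ_j(X)} F(B)` for a block activity `F` ("given `F : ℬ_j → 𝒩` and `X ∈ 𝒫_j`
we write `F^X = ∏_{B ∈ ℬ_j(X)} F(B)`"). [cite: BrydgesSlade2015RGV, §1.5 (before Lemma 1.2)] -/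
def blockProd {R : Type*} [CommMonoid R] (b : ℕ) (F : Finset (TorusSite d M) → R) (X : Finset (TorusSite d M)) : R :=
  ∏ B ∈ blocksOf b X, F B

/-- `F^∅ = 1`. [folklore] -/
@[simp] theorem blockProd_empty {R : Type*} [CommMonoid R] (b : ℕ) (F : Finset (TorusSite d M) → R) :
    blockProd b F ∅ = 1 := by
  simp [blockProd, blocksOf]

/-- Blocks of a polymer are contained in it. [folklore] -/
theorem subset_of_mem_blocksOf {b : ℕ} {X B : Finset (TorusSite d M)} (hX : IsPolymer b X) (hB : B ∈ blocksOf b X) :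
    B ⊆ X := by
  simp only [blocksOf, mem_image] at hB
  obtain ⟨x, hx, rfl⟩ := hB
  exact hX hx

/-- Blocks are nonempty. [folklore] -/
theorem nonempty_of_mem_blocksOf {b : ℕ} {X B : Finset (TorusSite d M)} (hB : B ∈ blocksOf b X) : B.Nonempty := by
  simp only [blocksOf, mem_image] at hB
  obtain ⟨x, -, rfl⟩ := hB
  exact ⟨x, mem_block_self b x⟩

/-- Members of `blocksOf` are blocks. [folklore] -/
theorem exists_eq_block_of_mem_blocksOf {b : ℕ} {X B : Finset (TorusSite d M)} (hB : B ∈ blocksOf b X) :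
    ∃ x ∈ X, B = block b x := by
  simp only [blocksOf, mem_image] at hB
  obtain ⟨x, hx, rfl⟩ := hB
  exact ⟨x, hx, rfl⟩

/-- `ℬ(X ∪ Y) = ℬ(X) ∪ ℬ(Y)`. [folklore] -/
theorem blocksOf_union {b : ℕ} (X Y : Finset (TorusSite d M)) : blocksOf b (X ∪ Y) = blocksOf b X ∪ blocksOf b Y := by
  simp [blocksOf, image_union]

/-- Disjoint polymers have disjoint block sets. [folklore] -/
theorem disjoint_blocksOf {b : ℕ} {X Y : Finset (TorusSite d M)} (hX : IsPolymer b X) (hY : IsPolymer b Y)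
    (h : Disjoint X Y) : Disjoint (blocksOf b X) (blocksOf b Y) := by
  rw [Finset.disjoint_left]
  intro B hBX hBY
  obtain ⟨x, hx⟩ := nonempty_of_mem_blocksOf hBX
  exact Finset.disjoint_left.1 h (subset_of_mem_blocksOf hX hBX hx) (subset_of_mem_blocksOf hY hBY hx)

/-- **`F^{X ∪ Y} = F^X F^Y` for disjoint polymers.** [folklore] -/
theorem blockProd_union {R : Type*} [CommMonoid R] {b : ℕ} (F : Finset (TorusSite d M) → R)
    {X Y : Finset (TorusSite d M)} (hX : IsPolymer b X) (hY : IsPolymer b Y) (h : Disjoint X Y) :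
    blockProd b F (X ∪ Y) = blockProd b F X * blockProd b F Y := by
  unfold blockProd
  rw [blocksOf_union, Finset.prod_union (disjoint_blocksOf hX hY h)]

/-- `F^W = F^V F^{W∖V}` for polymers `V ⊆ W`. [folklore] -/
theorem blockProd_eq_mul_sdiff {R : Type*} [CommMonoid R] {b : ℕ} (F : Finset (TorusSite d M) → R)
    {V W : Finset (TorusSite d M)} (hV : IsPolymer b V) (hW : IsPolymer b W) (h : V ⊆ W) :
    blockProd b F W = blockProd b F V * blockProd b F (W \ V) := by
  rw [← blockProd_union F hV (hW.sdiff hV) disjoint_sdiff, union_sdiff_of_subset h]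

/-- `F^B = F(B)` on a block. [folklore] -/
theorem blockProd_block {R : Type*} [CommMonoid R] {b : ℕ} (F : Finset (TorusSite d M) → R) (x : TorusSite d M) :
    blockProd b F (block b x) = F (block b x) := by
  unfold blockProd
  have : blocksOf b (block b x) = {block b x} := by
    ext B
    simp only [blocksOf, mem_image, mem_singleton]
    constructor
    · rintro ⟨y, hy, rfl⟩; exact block_eq_of_mem hy
    · rintro rfl; exact ⟨x, mem_block_self b x, rfl⟩
  rw [this, Finset.prod_singleton]

/-- `F^X` over a gas's union is the product over the members. [folklore] -/
theorem blockProd_biUnion_of_isGas {R : Type*} [CommMonoid R] {b : ℕ} (F : Finset (TorusSite d M) → R)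
    {G : Finset (Finset (TorusSite d M))} (hG : IsGas b G) :
    blockProd b F (G.biUnion id) = ∏ Y ∈ G, blockProd b F Y := by
  classical
  induction G using Finset.induction_on with
  | empty => simp
  | @insert Y G hY ih =>
    have hG' : IsGas b G := hG.subset (subset_insert _ _)
    rw [Finset.biUnion_insert, Finset.prod_insert hY, id,
      blockProd_union F (hG.1 Y (mem_insert_self _ _)).1 hG'.isPolymer_biUnion, ih hG']
    rw [Finset.disjoint_biUnion_right]
    intro Y' hY'
    exact disjoint_of_not_touch (hG.2 Y (mem_insert_self _ _) Y' (mem_insert_of_mem hY') (fun h => hY (h ▸ hY')))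

end Polymer

end LongRangePhi4

end Literature.Barriers.CriticalPhenomena
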